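import Literature.MathematicalPhysics.QuantumLattice.TwistedSpaceGroupUnitary
import HarnessLib

/-!
# Variational window certificates with GAUGE-TWISTED symmetry defects (`t–t'` Hubbard torus)

Twin of `HubbardNNNHoppingVariationalWindowCertificate` (the OP1-E reader of the hubbard-obs one-point
programme: an SOS/symmetry-defect identity in the window algebra, read in the space-group orbit state of an
ARBITRARY unit vector of the torus) for the TWISTED space group `TwistedSpaceGroupUnitary`
(`T(v, γ, m) = U_v D_γ 𝒢_{j(γ)+2m}`, `𝒢 = e^{iπN̂/2}`): the certificate's symmetry defects may now pair a
lattice element `γ` of `B₁g` sign `−1` with the gauge quarter turn, i.e. they read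
`b_l · (φ_l · Γ(incl)(Γ(d4Emb γ_l w_l) W_l) − Γ(incl) W_l)` with `W_l` a ladder word and
`φ_l = gaugePhase (twistExp γ_l m_l) W_l = i^{(j(γ_l)+2m_l)·q(W_l)}` — the dual certificates of eng-2's
TWISTED one-point builds (hubbard-obs PAIRCORR-SDP §13.14 (W8); ×3.8 fewer variables than the readable
`D₂` export, no transplant). Conclusion unchanged:
`c − Σ_k ‖a_k‖ + Σ_σ μ_σ (Re⟨ζ, N_σ ζ⟩/L² − ν) + κ (u − Re⟨ζ, H^{tt'}_L ζ⟩/L²) ≤ Re ω̄^{tw}_ζ(Γ(ι_{Λ',L}) X)`,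
`ω̄^{tw}_ζ = orbitState (twistedSpaceGroupUnitary S) ζ`.

* `hubbardTorusTT'_re_orbitState_ge_of_twisted_variational_certificate_ineq` — torus level (abstract
  identity on the torus algebra; defects `T Y Tᴴ − Y` with `T` in the twisted family);
* `re_orbitState_ge_of_twisted_window_variational_certificate_TT'_ineq` — window level (the node shape).

Everything is PROVED from `OrbitStateVariationalCertificate.re_orbitState_ge_of_variational_certificate_ineq`
(the abstract orbit-state reader) and the closure / commutation facts of `TwistedSpaceGroupUnitary`; no named
fact, no `sorry`. Wang et al. 2024 §III (energy rows), Han 2020 §3 (symmetry rows `F[U⁻¹OU] = F[O]`),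
Bratteli–Robinson II §5.2.2 (gauge automorphisms).

References: J. Wang et al., PRX 14 (2024) 031006, §III [WangEtAl2024]; X. Han, arXiv:2006.06002 §3
[Han2020Bootstrap]; O. Bratteli, D. W. Robinson, *Operator Algebras and Quantum Statistical Mechanics 2*,
§5.2.2 [BratteliRobinsonII1997].
-/

noncomputable section

namespace Literature.MathematicalPhysics.QuantumLattice

open Matrix Finset Complex HubbardWave0 Literature.Probability.LatticeModels
open Literature.MathematicalPhysics.QuantumManyBody.StateRelaxation
open scoped ComplexOrder BigOperators

/-- The gauge phase of a word depends only on its dagger flags (not on the orbitals). [cite: Han2020Bootstrap, §2] -/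
theorem gaugePhase_map_fst {ι ι' : Type*} (k : ℕ) (f : ι → ι') (l : List (ι × Bool)) :
    gaugePhase k (l.map fun p => (f p.1, p.2)) = gaugePhase k l := by
  induction l with
  | nil => simp
  | cons p l ih => simp [ih, gaugeLetterPhase]

/-! ### Torus level -/

section Torus

variable {L : ℕ} [NeZero L]

/-- (Local to this section.) [folklore] -/
local instance (priority := high) instDecidableEqFermionTorusTwW : DecidableEq (FermionTorus 2 L) :=
  LinearOrder.toDecidableEq

/-- **Variational certificate with twisted defects ⇒ twisted-orbit-averaged expectation in EVERY unit vector
of the `t–t'` torus.** As `hubbardTorusTT'_re_orbitState_ge_of_variational_certificate_ineq` with the averaging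
family `twistedSpaceGroupUnitary S` (`S ∋ 1` closed under multiplication) and symmetry defects
`T_l Y_l T_lᴴ − Y_l`, `T_l = U_{w_l} D_{γ_l} 𝒢_{j(γ_l)+2m_l}` (`γ_l ∈ S`). [cite: WangEtAl2024, §III] [cite: Han2020Bootstrap, §3] -/
theorem hubbardTorusTT'_re_orbitState_ge_of_twisted_variational_certificate_ineq (t t' U : ℝ)
    {S : Finset (DihedralGroup 4)} (h1 : (1 : DihedralGroup 4) ∈ S) (hmul : ∀ a ∈ S, ∀ b ∈ S, a * b ∈ S)
    (K : Submodule ℂ (Fock (Orb (FermionTorus 2 L))))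
    (hK : ∀ g : (TorusSite 2 L × ↥S) × Fin 2, ∀ φ ∈ K, (twistedSpaceGroupUnitary S g)ᴴ *ᵥ φ ∈ K)
    {ζ : Fock (Orb (FermionTorus 2 L))} (hζK : ζ ∈ K) (hζ1 : star ζ ⬝ᵥ ζ = 1)
    (X Eloc : Matrix (Finset (Orb (FermionTorus 2 L))) (Finset (Orb (FermionTorus 2 L))) ℂ)
    (hE : ∑ v : TorusSite 2 L, (fockTranslate v).val * Eloc * (fockTranslate v).valᴴ =
      hubbardTorusTT' L t t' U) (κ u : ℝ)
    {δ' : Type*} (dens : Finset δ') (μ ν : δ' → ℝ)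
    (D G : δ' → Matrix (Finset (Orb (FermionTorus 2 L))) (Finset (Orb (FermionTorus 2 L))) ℂ)
    (hD : ∀ i ∈ dens, ∑ v : TorusSite 2 L, (fockTranslate v).val * D i * (fockTranslate v).valᴴ = G i)
    (hG : ∀ i ∈ dens, ∀ g : (TorusSite 2 L × ↥S) × Fin 2,
      twistedSpaceGroupUnitary S g * G i = G i * twistedSpaceGroupUnitary S g)
    {m : Type*} [Fintype m] [DecidableEq m] {Λm : Matrix m m ℂ} (hΛ : Λm.PosSemidef)
    (O : m → Matrix (Finset (Orb (FermionTorus 2 L))) (Finset (Orb (FermionTorus 2 L))) ℂ)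
    {ι : Type*} (tt : Finset ι) (γ : ι → DihedralGroup 4) (hγS : ∀ l ∈ tt, γ l ∈ S)
    (wv : ι → TorusSite 2 L) (mt : ι → Fin 2)
    (Y : ι → Matrix (Finset (Orb (FermionTorus 2 L))) (Finset (Orb (FermionTorus 2 L))) ℂ)
    {ρ : Type*} (r : Finset ρ)
    (Q Z Z' : ρ → Matrix (Finset (Orb (FermionTorus 2 L))) (Finset (Orb (FermionTorus 2 L))) ℂ)
    (q : ρ → ℝ) (hQh : ∀ i ∈ r, (Q i).IsHermitian)
    (hQ : ∀ i ∈ r, ∀ φ ∈ K, Q i *ᵥ φ = ((q i : ℝ) : ℂ) • φ)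
    {γ' : Type*} (u' : Finset γ')
    (C W : γ' → Matrix (Finset (Orb (FermionTorus 2 L))) (Finset (Orb (FermionTorus 2 L))) ℂ)
    (qc : γ' → ℝ) (hCh : ∀ j ∈ u', (C j).IsHermitian)
    (hC : ∀ j ∈ u', ∀ φ ∈ K, C j *ᵥ φ = ((qc j : ℝ) : ℂ) • φ)
    {δ : Type*} (ah : Finset δ) (dc : δ → ℝ)
    (V : δ → Matrix (Finset (Orb (FermionTorus 2 L))) (Finset (Orb (FermionTorus 2 L))) ℂ)
    {κ'' : Type*} (w : Finset κ'') (a : κ'' → ℂ)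
    (M : κ'' → Matrix (Finset (Orb (FermionTorus 2 L))) (Finset (Orb (FermionTorus 2 L))) ℂ)
    (hM : ∀ k ∈ w, (M k).IsContraction) {c : ℝ}
    (hcert : X - (c : ℂ) • (1 : Matrix (Finset (Orb (FermionTorus 2 L))) (Finset (Orb (FermionTorus 2 L))) ℂ) -
        ∑ i ∈ dens, ((μ i : ℝ) : ℂ) • (D i - ((ν i : ℝ) : ℂ) •
          (1 : Matrix (Finset (Orb (FermionTorus 2 L))) (Finset (Orb (FermionTorus 2 L))) ℂ)) -
        ((κ : ℝ) : ℂ) • (((u : ℝ) : ℂ) •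
          (1 : Matrix (Finset (Orb (FermionTorus 2 L))) (Finset (Orb (FermionTorus 2 L))) ℂ) - Eloc) =
      gramForm Λm O +
        (∑ l ∈ tt, ((fockTranslate (wv l)).val * (fockD4 (L := L) (γ l)).val * fockGauge (twistExp (γ l) (mt l)) * Y l *
              ((fockTranslate (wv l)).val * (fockD4 (L := L) (γ l)).val * fockGauge (twistExp (γ l) (mt l)))ᴴ - Y l) +
          ∑ i ∈ r, (Z i * (Q i - ((q i : ℝ) : ℂ) • 1) + (Q i - ((q i : ℝ) : ℂ) • 1) * Z' i) +
          ∑ j ∈ u', (C j * W j - W j * C j)) +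
        (∑ m' ∈ ah, ((dc m' : ℝ) : ℂ) • ((V m')ᴴ - V m') + ∑ k ∈ w, a k • M k)) :
    c - ∑ k ∈ w, ‖a k‖ +
        ∑ i ∈ dens, μ i * ((star ζ ⬝ᵥ (G i *ᵥ ζ)).re / (L : ℝ) ^ 2 - ν i) +
        κ * (u - (star ζ ⬝ᵥ (hubbardTorusTT' L t t' U *ᵥ ζ)).re / (L : ℝ) ^ 2) ≤
      (orbitState (twistedSpaceGroupUnitary S) ζ X).re := by
  haveI : Nonempty ↥S := ⟨⟨1, h1⟩⟩
  have hUT : ∀ l ∈ tt, ∃ σ : ((TorusSite 2 L × ↥S) × Fin 2) ≃ ((TorusSite 2 L × ↥S) × Fin 2), ∀ g,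
      twistedSpaceGroupUnitary S g *
          ((fockTranslate (wv l)).val * (fockD4 (L := L) (γ l)).val * fockGauge (twistExp (γ l) (mt l))) =
        twistedSpaceGroupUnitary S (σ g) := fun l hl =>
    twistedSpaceGroupUnitary_closed (L := L) hmul (wv l) (hγS l hl) (mt l)
  have h := re_orbitState_ge_of_variational_certificate_ineq (hubbardTorusTT' L t t' U) K hζK hζ1
    (twistedSpaceGroupUnitary S) (fun g' => twistedSpaceGroupUnitary_mul_hubbardTorusTT' S t t' U g')
    (fun g' => twistedSpaceGroupUnitary_conjTranspose_mul_self S g') hK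
    (fun v => (fockTranslate v).val) (fun v => twistedSpaceGroupUnitary_closed_translate h1 hmul v)
    X Eloc hE κ u dens μ ν D G hD hG hΛ O tt
    (fun l => (fockTranslate (wv l)).val * (fockD4 (L := L) (γ l)).val * fockGauge (twistExp (γ l) (mt l))) Y
    hUT r Q Z Z' q hQh hQ u' C W qc hCh hC ah dc V w a M hM hcert
  rw [card_torusSite] at h
  push_cast at h
  exact h

end Torus

/-! ### Window level -/

section Window

variable {L : ℕ} [NeZero L]

/-- (Local to this section.) [folklore] -/
local instance (priority := high) instDecidableEqFermionTorusTwWin : DecidableEq (FermionTorus 2 L) :=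
  LinearOrder.toDecidableEq

/-- **Twisted variational window certificate ⇒ twisted-orbit-averaged expectation of a local observable in
EVERY unit vector of every large `t–t'` torus.** Data as in
`re_orbitState_ge_of_window_variational_certificate_d4_TT'_ineq` except that the symmetry defects are
`b_l • (φ_l • Γ(incl)(Γ(d4Emb γ_l w_l) W_l) − Γ(incl) W_l)` with `W_l = ladderWord (yw l)` a ladder word of the
inner window `Λ`, `φ_l = gaugePhase (twistExp γ_l m_l) (yw l)` (`= i^{(j(γ_l)+2m_l) q(W_l)}`) and `b_l ∈ ℂ`:
the identity in `𝔄_{Λ'}`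
`X − c·1 − Σ_σ μ_σ (n_{0σ} − ν·1) − κ (u·1 − Γ(incl) E^{tt'}_Φ) = Σ Λₐᵦ Oₐᴴ O_b
  + Σₗ bₗ • (φₗ • Γ(incl)(Γ(d4Emb γₗ wₗ) Wₗ) − Γ(incl) Wₗ) + (Σₘ dₘ • (Vₘᴴ − Vₘ) + Σₖ aₖ • vₖ)`.
Then for every `L ≥ 3` with `x ↦ x mod L` injective on `Λ'`, every finite `S ∋ 1` closed under multiplication
with `γₗ ∈ S`, and EVERY unit vector `ζ`:
`c − Σₖ ‖aₖ‖ + Σ_σ μ_σ (Re⟨ζ, N_σ ζ⟩/L² − ν) + κ (u − Re⟨ζ, H^{tt'}_L ζ⟩/L²) ≤ Re ω̄^{tw}_ζ(Γ(ι_{Λ',L}) X)`,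
`ω̄^{tw}_ζ = orbitState (twistedSpaceGroupUnitary S) ζ`. [cite: WangEtAl2024, §III] [cite: Han2020Bootstrap, §3] -/
theorem re_orbitState_ge_of_twisted_window_variational_certificate_TT'_ineq (t t' U : ℝ) (hL : 3 ≤ L)
    {Λ Λ' : Finset (Site 2)} (hΛ : Λ ⊆ Λ')
    (h0 : thicken ({0} : Finset (Site 2)) 1 ⊆ Λ') (hz : (0 : Site 2) ∈ Λ')
    (hInj' : Set.InjOn (Torus.proj (d := 2) L) ↑Λ')
    {S : Finset (DihedralGroup 4)} (h1 : (1 : DihedralGroup 4) ∈ S) (hmul : ∀ a ∈ S, ∀ b ∈ S, a * b ∈ S)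
    {ζ : Fock (Orb (FermionTorus 2 L))} (hζ1 : star ζ ⬝ᵥ ζ = 1)
    (Xw : FermionOp Λ') (κ u : ℝ) (μ : Fin 2 → ℝ) (ν : ℝ)
    {m : Type*} [Fintype m] [DecidableEq m] {Λm : Matrix m m ℂ} (hΛm : Λm.PosSemidef)
    (O : m → FermionOp Λ')
    {ι : Type*} (tt : Finset ι) (γ : ι → DihedralGroup 4) (hγS : ∀ l ∈ tt, γ l ∈ S) (wv : ι → Site 2)
    (mt : ι → Fin 2) (hsh : ∀ l, d4ShiftSet (γ l) (wv l) Λ ⊆ Λ') (b : ι → ℂ)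
    (yw : ι → List (Orb (PolySite Λ) × Bool))
    {δ : Type*} (ah : Finset δ) (dc : δ → ℝ) (V : δ → FermionOp Λ')
    {κ'' : Type*} (w : Finset κ'') (a : κ'' → ℂ) (word : κ'' → List (Orb (PolySite Λ') × Bool)) {c : ℝ}
    (hcert : Xw - (c : ℂ) • (1 : FermionOp Λ') -
        ∑ σ : Fin 2, ((μ σ : ℝ) : ℂ) • (nAt 0 hz σ - ((ν : ℝ) : ℂ) • (1 : FermionOp Λ')) -
        ((κ : ℝ) : ℂ) • (((u : ℝ) : ℂ) • (1 : FermionOp Λ') -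
          fermionEmbed (PolySite.incl h0) ((hubbardTTPrimeFermionInteraction t t' U).meanEnergyObs 1)) =
      gramForm Λm O +
        ∑ l ∈ tt, b l • (gaugePhase (twistExp (γ l) (mt l)) (yw l) •
            fermionEmbed (PolySite.incl (hsh l)) (fermionEmbed (PolySite.d4Emb (γ l) (wv l) Λ) (ladderWord (yw l))) -
            fermionEmbed (PolySite.incl hΛ) (ladderWord (yw l))) +
        (∑ m' ∈ ah, ((dc m' : ℝ) : ℂ) • ((V m')ᴴ - V m') + ∑ k ∈ w, a k • ladderWord (word k))) :
    c - ∑ k ∈ w, ‖a k‖ +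
        ∑ σ : Fin 2, μ σ * ((star ζ ⬝ᵥ ((∑ y : FermionTorus 2 L, numberOp y σ) *ᵥ ζ)).re / (L : ℝ) ^ 2 - ν) +
        κ * (u - (star ζ ⬝ᵥ (hubbardTorusTT' L t t' U *ᵥ ζ)).re / (L : ℝ) ^ 2) ≤
      (orbitState (twistedSpaceGroupUnitary S) ζ (fermionEmbed (PolySite.toTorusEmb L hInj') Xw)).re := by
  have hInjΛ : Set.InjOn (Torus.proj (d := 2) L) ↑Λ := hInj'.mono (by exact_mod_cast hΛ)
  have hInj0 : Set.InjOn (Torus.proj (d := 2) L) ↑(thicken ({0} : Finset (Site 2)) 1) :=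
    hInj'.mono (by exact_mod_cast h0)
  set Γ' := fermionEmbed (PolySite.toTorusEmb L hInj') with hΓ'
  set ΓΛ := fermionEmbed (PolySite.toTorusEmb L hInjΛ) with hΓΛ
  set H := hubbardTorusTT' L t t' U with hH
  set EΦ := (hubbardTTPrimeFermionInteraction t t' U).meanEnergyObs 1 with hEΦ
  -- the local energy `Γ(ι₀) E_Φ`, whose translates sum to `H`
  set X := Γ' (fermionEmbed (PolySite.incl h0) EΦ) with hX
  have hX0 : X = fermionEmbed (PolySite.toTorusEmb L hInj0) EΦ := fermionEmbed_toTorusEmb_incl h0 hInj' EΦ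
  have hsum : ∑ v' : TorusSite 2 L, (fockTranslate v').val * X * (fockTranslate v').valᴴ = H := by
    rw [hX0]
    have h := sum_relabel_translate_hubbardTTPrime_meanEnergyObs (L := L) t' t U hL
    simp_rw [relabel_eq_fockRelabel_conj] at h
    exact h
  -- density observables
  set D : Fin 2 → Matrix (Finset (Orb (FermionTorus 2 L))) (Finset (Orb (FermionTorus 2 L))) ℂ :=
    fun σ => numberOp (FermionTorus.ofTorusSite (0 : TorusSite 2 L)) σ with hD
  set G : Fin 2 → Matrix (Finset (Orb (FermionTorus 2 L))) (Finset (Orb (FermionTorus 2 L))) ℂ :=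
    fun σ => ∑ y : FermionTorus 2 L, numberOp y σ with hG
  have hDΓ : ∀ σ, Γ' (nAt 0 hz σ) = D σ := fun σ => fermionEmbed_toTorusEmb_nAt_zero hz hInj' σ
  have hDsum : ∀ σ ∈ (Finset.univ : Finset (Fin 2)),
      ∑ v' : TorusSite 2 L, (fockTranslate v').val * D σ * (fockTranslate v').valᴴ = G σ :=
    fun σ _ => sum_conj_fockTranslate_numberOp 0 σ
  have hGT : ∀ σ ∈ (Finset.univ : Finset (Fin 2)), ∀ g : (TorusSite 2 L × ↥S) × Fin 2,
      twistedSpaceGroupUnitary S g * G σ = G σ * twistedSpaceGroupUnitary S g :=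
    fun σ _ g => twistedSpaceGroupUnitary_commute_spinNumber S g σ
  -- symmetry family: the torus images of the words `W_l`, with their coefficients
  set emb0 : Orb (PolySite Λ) × Bool → Orb (FermionTorus 2 L) × Bool :=
    fun p => (Orb.embMap (PolySite.toTorusEmb L hInjΛ) p.1, p.2) with hemb0
  set Yt : ι → Matrix (Finset (Orb (FermionTorus 2 L))) (Finset (Orb (FermionTorus 2 L))) ℂ :=
    fun l => b l • ΓΛ (ladderWord (yw l)) with hYt
  have hYtw : ∀ l, ΓΛ (ladderWord (yw l)) = ladderWord ((yw l).map emb0) := fun l => by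
    rw [hΓΛ, fermionEmbed_ladderWord]
  -- residual words
  set emb : Orb (PolySite Λ') × Bool → Orb (FermionTorus 2 L) × Bool :=
    fun p => (Orb.embMap (PolySite.toTorusEmb L hInj') p.1, p.2) with hemb
  set M : κ'' → Matrix (Finset (Orb (FermionTorus 2 L))) (Finset (Orb (FermionTorus 2 L))) ℂ :=
    fun k => ladderWord ((word k).map emb) with hM
  have hMc : ∀ k ∈ w, (M k).IsContraction := fun k _ => by
    rw [hM]; dsimp only; rw [ladderWord_eq_prod]; exact isContraction_prod_ladder _
  -- the left-hand side, pulled back into the torus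
  have hlhs : Γ' (Xw - (c : ℂ) • (1 : FermionOp Λ') -
        ∑ σ : Fin 2, ((μ σ : ℝ) : ℂ) • (nAt 0 hz σ - ((ν : ℝ) : ℂ) • (1 : FermionOp Λ')) -
        ((κ : ℝ) : ℂ) • (((u : ℝ) : ℂ) • (1 : FermionOp Λ') - fermionEmbed (PolySite.incl h0) EΦ)) =
      Γ' Xw - (c : ℂ) • (1 : Matrix (Finset (Orb (FermionTorus 2 L))) (Finset (Orb (FermionTorus 2 L))) ℂ) -
        ∑ σ ∈ (Finset.univ : Finset (Fin 2)), ((μ σ : ℝ) : ℂ) • (D σ - ((ν : ℝ) : ℂ) •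
          (1 : Matrix (Finset (Orb (FermionTorus 2 L))) (Finset (Orb (FermionTorus 2 L))) ℂ)) -
        ((κ : ℝ) : ℂ) • (((u : ℝ) : ℂ) •
          (1 : Matrix (Finset (Orb (FermionTorus 2 L))) (Finset (Orb (FermionTorus 2 L))) ℂ) - X) := by
    have hs : Γ' (∑ σ : Fin 2, ((μ σ : ℝ) : ℂ) • (nAt 0 hz σ - ((ν : ℝ) : ℂ) • (1 : FermionOp Λ'))) =
        ∑ σ ∈ (Finset.univ : Finset (Fin 2)), ((μ σ : ℝ) : ℂ) • (D σ - ((ν : ℝ) : ℂ) •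
          (1 : Matrix (Finset (Orb (FermionTorus 2 L))) (Finset (Orb (FermionTorus 2 L))) ℂ)) := by
      rw [map_sum]
      exact Finset.sum_congr rfl fun σ _ => by rw [map_smul, map_sub, map_smul, map_one, hDΓ]
    have hk : Γ' (((κ : ℝ) : ℂ) • (((u : ℝ) : ℂ) • (1 : FermionOp Λ') - fermionEmbed (PolySite.incl h0) EΦ)) =
        ((κ : ℝ) : ℂ) • (((u : ℝ) : ℂ) •
          (1 : Matrix (Finset (Orb (FermionTorus 2 L))) (Finset (Orb (FermionTorus 2 L))) ℂ) - X) := by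
      rw [map_smul, map_sub, map_smul, map_one, hX]
    rw [map_sub, hk, map_sub, hs, map_sub, map_smul, map_one]
  -- the twisted defects, pulled back into the torus
  have h2l : ∀ l ∈ tt, Γ' (b l • (gaugePhase (twistExp (γ l) (mt l)) (yw l) •
        fermionEmbed (PolySite.incl (hsh l)) (fermionEmbed (PolySite.d4Emb (γ l) (wv l) Λ) (ladderWord (yw l))) -
        fermionEmbed (PolySite.incl hΛ) (ladderWord (yw l)))) =
      (fockTranslate (Torus.proj L (wv l))).val * (fockD4 (L := L) (γ l)).val * fockGauge (twistExp (γ l) (mt l)) *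
          Yt l *
        ((fockTranslate (Torus.proj L (wv l))).val * (fockD4 (L := L) (γ l)).val *
          fockGauge (twistExp (γ l) (mt l)))ᴴ - Yt l := by
    intro l _
    -- right-hand side: conjugate by the gauge factor first
    have hgauge : fockGauge (twistExp (γ l) (mt l)) * Yt l * (fockGauge (twistExp (γ l) (mt l)))ᴴ =
        gaugePhase (twistExp (γ l) (mt l)) (yw l) • Yt l := by
      rw [hYt]; dsimp only
      rw [Matrix.mul_smul, Matrix.smul_mul, hYtw l, fockGauge_conj_ladderWord, hemb0, gaugePhase_map_fst, smul_comm]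
    have hrhs : (fockTranslate (Torus.proj L (wv l))).val * (fockD4 (L := L) (γ l)).val *
          fockGauge (twistExp (γ l) (mt l)) * Yt l *
          ((fockTranslate (Torus.proj L (wv l))).val * (fockD4 (L := L) (γ l)).val *
            fockGauge (twistExp (γ l) (mt l)))ᴴ =
        gaugePhase (twistExp (γ l) (mt l)) (yw l) •
          ((fockTranslate (Torus.proj L (wv l))).val * (fockD4 (L := L) (γ l)).val * Yt l *
            ((fockTranslate (Torus.proj L (wv l))).val * (fockD4 (L := L) (γ l)).val)ᴴ) := by
      rw [conjTranspose_mul ((fockTranslate (Torus.proj L (wv l))).val * (fockD4 (L := L) (γ l)).val)]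
      have : (fockTranslate (Torus.proj L (wv l))).val * (fockD4 (L := L) (γ l)).val *
            fockGauge (twistExp (γ l) (mt l)) * Yt l *
            ((fockGauge (twistExp (γ l) (mt l)))ᴴ *
              ((fockTranslate (Torus.proj L (wv l))).val * (fockD4 (L := L) (γ l)).val)ᴴ) =
          (fockTranslate (Torus.proj L (wv l))).val * (fockD4 (L := L) (γ l)).val *
            (fockGauge (twistExp (γ l) (mt l)) * Yt l * (fockGauge (twistExp (γ l) (mt l)))ᴴ) *
            ((fockTranslate (Torus.proj L (wv l))).val * (fockD4 (L := L) (γ l)).val)ᴴ := by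
        simp only [Matrix.mul_assoc]
      rw [this, hgauge, Matrix.mul_smul, Matrix.smul_mul]
    rw [hrhs, map_smul, map_sub, map_smul, fermionEmbed_toTorusEmb_incl (hsh l) hInj',
      fermionEmbed_toTorusEmb_incl hΛ hInj',
      fermionEmbed_toTorusEmb_d4Emb (γ l) (wv l) hInjΛ (hInj'.mono (by exact_mod_cast (hsh l))) (ladderWord (yw l)),
      ← d4Affine_conj, hYt]
    dsimp only
    rw [hΓΛ, Matrix.mul_smul, Matrix.smul_mul, smul_sub, smul_comm]
  -- the identity, pulled back into the torus (empty sector and charge families)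
  have htorus : Γ' Xw - (c : ℂ) • (1 : Matrix (Finset (Orb (FermionTorus 2 L))) (Finset (Orb (FermionTorus 2 L))) ℂ) -
      ∑ σ ∈ (Finset.univ : Finset (Fin 2)), ((μ σ : ℝ) : ℂ) • (D σ - ((ν : ℝ) : ℂ) •
        (1 : Matrix (Finset (Orb (FermionTorus 2 L))) (Finset (Orb (FermionTorus 2 L))) ℂ)) -
      ((κ : ℝ) : ℂ) • (((u : ℝ) : ℂ) •
        (1 : Matrix (Finset (Orb (FermionTorus 2 L))) (Finset (Orb (FermionTorus 2 L))) ℂ) - X) =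
      gramForm Λm (fun i => Γ' (O i)) +
        (∑ l ∈ tt, ((fockTranslate (Torus.proj L (wv l))).val * (fockD4 (L := L) (γ l)).val *
              fockGauge (twistExp (γ l) (mt l)) * Yt l *
              ((fockTranslate (Torus.proj L (wv l))).val * (fockD4 (L := L) (γ l)).val *
                fockGauge (twistExp (γ l) (mt l)))ᴴ - Yt l) +
          ∑ i ∈ (∅ : Finset (Fin 0)), ((0 : Matrix _ _ ℂ) * ((0 : Matrix _ _ ℂ) - (((0 : ℝ) : ℝ) : ℂ) • 1) +
            ((0 : Matrix _ _ ℂ) - (((0 : ℝ) : ℝ) : ℂ) • 1) * (0 : Matrix _ _ ℂ)) +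
          ∑ j ∈ (∅ : Finset (Fin 0)), ((0 : Matrix _ _ ℂ) * (0 : Matrix _ _ ℂ) - (0 : Matrix _ _ ℂ) * (0 : Matrix _ _ ℂ))) +
        (∑ m' ∈ ah, ((dc m' : ℝ) : ℂ) • ((Γ' (V m'))ᴴ - Γ' (V m')) + ∑ k ∈ w, a k • M k) := by
    have key := congrArg Γ' hcert
    rw [hlhs] at key
    have h2 : Γ' (∑ l ∈ tt, b l • (gaugePhase (twistExp (γ l) (mt l)) (yw l) •
          fermionEmbed (PolySite.incl (hsh l)) (fermionEmbed (PolySite.d4Emb (γ l) (wv l) Λ) (ladderWord (yw l))) -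
          fermionEmbed (PolySite.incl hΛ) (ladderWord (yw l)))) =
        ∑ l ∈ tt, ((fockTranslate (Torus.proj L (wv l))).val * (fockD4 (L := L) (γ l)).val *
              fockGauge (twistExp (γ l) (mt l)) * Yt l *
            ((fockTranslate (Torus.proj L (wv l))).val * (fockD4 (L := L) (γ l)).val *
              fockGauge (twistExp (γ l) (mt l)))ᴴ - Yt l) := by
      rw [map_sum]
      exact Finset.sum_congr rfl h2l
    have h4 : Γ' (∑ m' ∈ ah, ((dc m' : ℝ) : ℂ) • ((V m')ᴴ - V m')) =
        ∑ m' ∈ ah, ((dc m' : ℝ) : ℂ) • ((Γ' (V m'))ᴴ - Γ' (V m')) := by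
      rw [map_sum]
      refine Finset.sum_congr rfl fun m' _ => ?_
      rw [map_smul, map_sub, hΓ', fermionEmbed_conjTranspose]
    have h5 : Γ' (∑ k ∈ w, a k • ladderWord (word k)) = ∑ k ∈ w, a k • M k := by
      rw [map_sum]
      refine Finset.sum_congr rfl fun k _ => ?_
      rw [map_smul, hM, hΓ', fermionEmbed_ladderWord]
    rw [key, map_add, map_add, map_add, hΓ', fermionEmbed_gramForm, ← hΓ', h2, h4, h5,
      Finset.sum_empty, Finset.sum_empty, add_zero, add_zero]
  have hmain := hubbardTorusTT'_re_orbitState_ge_of_twisted_variational_certificate_ineq t t' U h1 hmul ⊤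
    (fun _ _ _ => Submodule.mem_top) (Submodule.mem_top : ζ ∈ (⊤ : Submodule ℂ _)) hζ1
    (Γ' Xw) X hsum κ u (Finset.univ : Finset (Fin 2)) μ (fun _ => ν) D G hDsum hGT hΛm
    (fun i => Γ' (O i)) tt γ hγS (fun l => Torus.proj L (wv l)) mt Yt
    (∅ : Finset (Fin 0)) (fun _ => 0) (fun _ => 0) (fun _ => 0) (fun _ => 0)
    (fun i hi => absurd hi (Finset.notMem_empty i)) (fun i hi => absurd hi (Finset.notMem_empty i))
    (∅ : Finset (Fin 0)) (fun _ => 0) (fun _ => 0) (fun _ => 0)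
    (fun i hi => absurd hi (Finset.notMem_empty i)) (fun i hi => absurd hi (Finset.notMem_empty i))
    ah dc (fun m' => Γ' (V m')) w a M hMc htorus
  exact hmain

end Window

end Literature.MathematicalPhysics.QuantumLattice

end
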